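import Mathlib
import Literature.Analysis.FluidPDE.VectorCalculus
import Summits.NavierStokesRegularity.NavierStokesRegularity.Theorems.ThreadingFluxErtelTowerViscousLevelTwo
import HarnessLib

/-!
# Crux `PoloidalLiouville` (stmt-NavierStokesRegularity-1222, W1), crux idea «radial-jerk-tower» (ns-idea-15 g7):
# THE VISCOUS ERTEL COMMUTATION — general level function `θ`

Support file (`--supports stmt-NavierStokesRegularity-1222`, helper).  Experiment cell `ns-wall-extremal`, width hand
ns-wall-eng-5 g8, item (ζ) (critic of record ns-wall-crit-1 g6, batch #9: «tool, S–M»).  0 kit.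

The docstring of the sketch Prop `ErtelCommutation` (Defs twin p692432) states, in parentheses, the Navier–Stokes form of Ertel's
commutation: `(Dₜ − νΔ)⟪ω, ∇θ⟫ = ⟪ω, ∇((Dₜ − νΔ)θ)⟫ − 2ν Σᵢⱼ ∂ᵢωⱼ ∂ᵢ∂ⱼθ`.  The tree has it only at level 1 of the radial-jerk tower
(`viscous_level_two`, `ViscousLevelTwoLaw`: `θ = m = ⟪v, x − x₀⟫` for an unthreaded flow, where `⟪ω, ∇m⟫ ≡ 0`).  This file proves it
for an ARBITRARY smooth `θ` and an arbitrary smooth Navier–Stokes flow (ν = 1) on an open space-time set — the closed-form generator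
of ALL viscous levels of the tower («viscosity relaxes algebraic rigidity into growth»):

* ★ `viscous_ertel_commutation` —
  `∂ₜ⟪ω,∇θ⟫ + ⟪v, ∇⟪ω,∇θ⟫⟫ − Δ⟪ω,∇θ⟫ = ⟪ω, ∇(∂ₜθ + ⟪v,∇θ⟫ − Δθ)⟫ − 2 Σᵢⱼ (∂ᵢωⱼ)(∂ᵢ∂ⱼθ)` on `I × U`,
  from the tree's Ertel commutation with source (`ertel_commutation`, source `= Δω` by `vorticity_transport_viscous`) and the local
  Leibniz rule `Δ⟪ω,∇θ⟫ = ⟪Δω,∇θ⟫ + ⟪ω,∇Δθ⟫ + 2Σᵢ⟪∂ᵢω,∂ᵢ∇θ⟫` (`laplacian_inner_of_contDiffOn`, `laplacian_gradient_of_contDiffOn`,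
  `sum_inner_fderiv_gradient_eq`); no unthreadedness is used;
* `viscous_ertel_step` — corollary: if `⟪ω, ∇θ⟫ ≡ 0` on `I × U` then `⟪ω, ∇((Dₜ − Δ)θ)⟫ = 2 Σᵢⱼ ∂ᵢωⱼ ∂ᵢ∂ⱼθ` there (the shape of
  `viscous_level_two`, for any vortex-line integral `θ`).

HONEST FRAME: a calculus identity for smooth NS flows; closes no crux or sketch Prop; `PoloidalLiouville` (1222) and NS regularity OPEN.
-/

-- the summit and its single problem share the name (D-0017 nested layout)
set_option linter.dupNamespace false

noncomputable section

namespace Summit.NavierStokesRegularity.NavierStokesRegularity.Theorems.PoloidalLiouville.ErtelTower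

open Set Function Filter Topology Metric
open scoped Topology RealInnerProductSpace InnerProductSpace
open Literature.Analysis.FluidPDE
open Summit.NavierStokesRegularity.NavierStokesRegularity.Theorems.PoloidalLiouville.HorizonTower (E3)

section Viscous

variable {v : ℝ → E3 → E3} {p θ : ℝ → E3 → ℝ} {I : Set ℝ} {U : Set E3}

/-- ★ **THE VISCOUS ERTEL COMMUTATION (general `θ`).**  For a smooth Navier–Stokes flow (`∂ₜv + Dv[v] + ∇p = Δv`, `div v = 0`)
on the open `I × U` and ANY jointly smooth scalar `θ` there, with `ω = curl v` and `Dₜ = ∂ₜ + v·∇`: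
`(Dₜ − Δ)⟪ω, ∇θ⟫ = ⟪ω, ∇((Dₜ − Δ)θ)⟫ − 2 Σᵢⱼ (∂ᵢωⱼ)(∂ᵢ∂ⱼθ)` at every point of `I × U`. -/
theorem viscous_ertel_commutation (hI : IsOpen I) (hU : IsOpen U)
    (hv : ContDiffOn ℝ (⊤ : ℕ∞) (Function.uncurry v) (I ×ˢ U))
    (hp : ContDiffOn ℝ (⊤ : ℕ∞) (Function.uncurry p) (I ×ˢ U))
    (hθ : ContDiffOn ℝ (⊤ : ℕ∞) (Function.uncurry θ) (I ×ˢ U))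
    (hns : ∀ t ∈ I, ∀ x ∈ U, deriv (fun s => v s x) t + fderiv ℝ (v t) x (v t x) + gradient (p t) x
        = Laplacian.laplacian (v t) x)
    (hdiv : ∀ t ∈ I, ∀ x ∈ U, Literature.Analysis.FluidPDE.VectorCalculus.divergence (v t) x = 0) :
    ∀ t ∈ I, ∀ x ∈ U,
      deriv (fun s => inner ℝ (curl (v s) x) (gradient (θ s) x)) t
          + inner ℝ (v t x) (gradient (fun z => inner ℝ (curl (v t) z) (gradient (θ t) z)) x)
          - Laplacian.laplacian (fun z => inner ℝ (curl (v t) z) (gradient (θ t) z)) x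
        = inner ℝ (curl (v t) x)
            (gradient (fun z => deriv (fun s => θ s z) t + inner ℝ (v t z) (gradient (θ t) z)
              - Laplacian.laplacian (θ t) z) x)
          - 2 * ∑ i : Fin 3, ∑ j : Fin 3,
              (fderiv ℝ (fun z => (curl (v t) z) j) x (EuclideanSpace.single i 1))
                * (fderiv ℝ (fun z => fderiv ℝ (θ t) z (EuclideanSpace.single j 1)) x (EuclideanSpace.single i 1)) := by
  intro t ht x hx
  have hB : ContDiffOn ℝ (⊤ : ℕ∞) (Function.uncurry fun s z => curl (v s) z) (I ×ˢ U) :=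
    contDiffOn_curl_uncurry hv hI hU
  have hωU : ContDiffOn ℝ (⊤ : ℕ∞) (curl (v t)) U := contDiffOn_slice hB ht
  have hθU : ContDiffOn ℝ (⊤ : ℕ∞) (θ t) U := contDiffOn_slice hθ ht
  have hωd : DifferentiableAt ℝ (curl (v t)) x := (hωU.differentiableOn (by simp)).differentiableAt (hU.mem_nhds hx)
  have hgradU : ContDiffOn ℝ (⊤ : ℕ∞) (gradient (θ t)) U := by
    have h : ContDiffOn ℝ (⊤ : ℕ∞) (fderiv ℝ (θ t)) U := hθU.fderiv_of_isOpen hU (by simp)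
    exact (InnerProductSpace.toDual ℝ E3).symm.contDiff.comp_contDiffOn h
  have hgradd : DifferentiableAt ℝ (gradient (θ t)) x :=
    (hgradU.differentiableOn (by simp)).differentiableAt (hU.mem_nhds hx)
  -- Ertel with source `S = Δω`
  have hE := ertel_commutation (u := v) (B := fun s z => curl (v s) z) (θ := θ) hI hU hv hB hθ t ht x hx
  rw [vorticity_transport_viscous hI hU hv hp hns hdiv t ht x hx] at hE
  -- Leibniz for `Δ⟪ω, ∇θ⟫`, with `Δ∇θ = ∇Δθ`
  have hL := laplacian_inner_of_contDiffOn (F := curl (v t)) (G := gradient (θ t)) hU hωU hgradU hx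
  rw [laplacian_gradient_of_contDiffOn hU hθU hx, sum_inner_fderiv_gradient_eq hωd hgradd] at hL
  -- split the gradient of the difference `Dₜθ − Δθ`
  have hA : DifferentiableAt ℝ (fun z => deriv (fun s => θ s z) t + inner ℝ (v t z) (gradient (θ t) z)) x := by
    have h := contDiffOn_slice (contDiffOn_succ hv hθ hI hU) ht
    exact (h.differentiableOn (by simp)).differentiableAt (hU.mem_nhds hx)
  obtain ⟨g, hg, hθg⟩ := exists_contDiff_eventuallyEq hU hθU hx
  have hΔev : Laplacian.laplacian (θ t) =ᶠ[𝓝 x] Laplacian.laplacian g := InnerProductSpace.laplacian_congr_nhds hθg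
  have hC : DifferentiableAt ℝ (Laplacian.laplacian (θ t)) x := by
    refine DifferentiableAt.congr_of_eventuallyEq ?_ hΔev
    have hΔg : ContDiff ℝ 1 (Laplacian.laplacian g) := contDiff_laplacian (n := 1) (hg.of_le (by norm_cast))
    exact hΔg.differentiable (by simp) x
  have hsplit : gradient (fun z => deriv (fun s => θ s z) t + inner ℝ (v t z) (gradient (θ t) z)
        - Laplacian.laplacian (θ t) z) x
      = gradient (fun z => deriv (fun s => θ s z) t + inner ℝ (v t z) (gradient (θ t) z)) x
        - gradient (Laplacian.laplacian (θ t)) x := by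
    rw [gradient, gradient, gradient, ← map_sub, fderiv_fun_sub hA hC]
  rw [hsplit, inner_sub_right, hE, hL]
  ring

/-- **Viscous Ertel step**: if `θ` is a vortex-line integral on `I × U` (`⟪ω, ∇θ⟫ ≡ 0`), then
`⟪ω, ∇((Dₜ − Δ)θ)⟫ = 2 Σᵢⱼ (∂ᵢωⱼ)(∂ᵢ∂ⱼθ)` there — the successor of `θ` in the VISCOUS tower is a vortex-line integral only up to
the explicit commutator (for `θ = ⟪v, x − x₀⟫` this is `viscous_level_two`). -/
theorem viscous_ertel_step (hI : IsOpen I) (hU : IsOpen U)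
    (hv : ContDiffOn ℝ (⊤ : ℕ∞) (Function.uncurry v) (I ×ˢ U))
    (hp : ContDiffOn ℝ (⊤ : ℕ∞) (Function.uncurry p) (I ×ˢ U))
    (hθ : ContDiffOn ℝ (⊤ : ℕ∞) (Function.uncurry θ) (I ×ˢ U))
    (hns : ∀ t ∈ I, ∀ x ∈ U, deriv (fun s => v s x) t + fderiv ℝ (v t) x (v t x) + gradient (p t) x
        = Laplacian.laplacian (v t) x)
    (hdiv : ∀ t ∈ I, ∀ x ∈ U, Literature.Analysis.FluidPDE.VectorCalculus.divergence (v t) x = 0)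
    (hlevel : ∀ t ∈ I, ∀ x ∈ U, inner ℝ (curl (v t) x) (gradient (θ t) x) = 0) :
    ∀ t ∈ I, ∀ x ∈ U,
      inner ℝ (curl (v t) x)
          (gradient (fun z => deriv (fun s => θ s z) t + inner ℝ (v t z) (gradient (θ t) z)
            - Laplacian.laplacian (θ t) z) x)
        = 2 * ∑ i : Fin 3, ∑ j : Fin 3,
            (fderiv ℝ (fun z => (curl (v t) z) j) x (EuclideanSpace.single i 1))
              * (fderiv ℝ (fun z => fderiv ℝ (θ t) z (EuclideanSpace.single j 1)) x (EuclideanSpace.single i 1)) := by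
  intro t ht x hx
  have h := viscous_ertel_commutation hI hU hv hp hθ hns hdiv t ht x hx
  -- the left-hand side vanishes identically near `(t, x)`
  have hev_t : (fun s => inner ℝ (curl (v s) x) (gradient (θ s) x)) =ᶠ[𝓝 t] fun _ => (0 : ℝ) := by
    filter_upwards [hI.mem_nhds ht] with s hs using hlevel s hs x hx
  have hev_x : (fun z => inner ℝ (curl (v t) z) (gradient (θ t) z)) =ᶠ[𝓝 x] fun _ => (0 : ℝ) := by
    filter_upwards [hU.mem_nhds hx] with z hz using hlevel t ht z hz
  have h1 : deriv (fun s => inner ℝ (curl (v s) x) (gradient (θ s) x)) t = 0 := by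
    rw [hev_t.deriv_eq, deriv_const]
  have h2 : gradient (fun z => inner ℝ (curl (v t) z) (gradient (θ t) z)) x = 0 := by
    rw [(gradient_congr_nhds hev_x).eq_of_nhds]
    simp [gradient]
  have h3 : Laplacian.laplacian (fun z => inner ℝ (curl (v t) z) (gradient (θ t) z)) x = 0 := by
    rw [(InnerProductSpace.laplacian_congr_nhds hev_x).eq_of_nhds]
    simp
  rw [h1, h2, h3, inner_zero_right] at h
  linarith

end Viscous

end Summit.NavierStokesRegularity.NavierStokesRegularity.Theorems.PoloidalLiouville.ErtelTower

end
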